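import Summits.ValiantsHypothesis.ValiantsHypothesis.Theses.LiftNullstellensatz
import Summits.ValiantsHypothesis.ValiantsHypothesis.Theses.DetQP
import Summits.ValiantsHypothesis.ValiantsHypothesis.Theorems.LiftNullstellensatzPerLiftQPOfVP
import Summits.ValiantsHypothesis.ValiantsHypothesis.Theorems.DetqpThesis.Negative.IffPerNotVQP

/-!
# Route `LiftNullstellensatz` — calibration of the deciding crux `LiftAvoidanceQP`
# (stmt-ValiantsHypothesis-5919): it implies the Extended Valiant Hypothesis over `ℂ`

Strategist's calibration (crux-strategist seat `cstrat-stmt-ValiantsHypothesis-5919-r1`, RESTATED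
re-audit).  The route dossier READS the deciding crux
`X = LiftAvoidanceQP` ("for every `c`, for all large `n`, every word lift of `per_n` has a
sequential flattening of rank `> 2^((log₂ n + c)^c)`") as the Extended Valiant Hypothesis in
ABP-width form; the tree carried no theorem saying so for THIS crux.  Its two siblings have one:
`DetQP.DetqpThesis` (`detqpThesis_iff_extendedValiantHypothesis`, Negative/IffPerNotVQP.lean) and
`ElementaryWordLength.WordLengthQP` (`wordLengthQP_iff_extendedValiantHypothesis`).  This file
supplies, from tree theorems only:

* `exists_lifts_of_isQPBounded_dc` — quasi-polynomial determinantal complexity of the permanent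
  family gives, for some `c` and EVERY `n`, a word lift of `per_n` all of whose sequential
  flattenings have rank `≤ 2^((log₂ n + c)^c)` (the body of the landed `perLiftQPOfVP_proof`:
  attained determinantal expression, von zur Gathen regularity, Chatterjee–Kumar–Volk Krylov
  normal form `ρᵀ L^(n-2) γ`, matrix product state, Nisan's easy direction);
* `extendedValiantHypothesis_of_liftAvoidanceQP` — hence `X → ExtendedValiantHypothesis ℂ`
  (the proof passes through the sibling crux `DetQP.DetqpThesis`, i.e. `X ⇒ DetqpThesis`; no
  separate cross-route edge is declared)
  (`¬ (VNP ℂ ⊆ VQP ℂ)`, BCS97 (21.32)), i.e. the crux is AT LEAST the Extended Valiant Hypothesis,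
  which is strictly stronger than the summit `VP ℂ ≠ VNP ℂ` in belief (per could be a
  qp-projection of det while `VP ≠ VNP`);
* `liftAvoidanceQP_io_suffices` — the deciding theorem consumes only the INFINITELY-OFTEN form of
  `X` ("for every `c` and `n₀` there is `n ≥ n₀` at which every lift has a large cut"); the filed
  crux is the ALMOST-EVERYWHERE form, which implies it (`liftAvoidanceQP_io_of_ae`).  The converse
  (i.o. ⇒ a.e.) is not claimed: it would need a regularity property of `n ↦ liftTTRank (per_n)`
  beyond the monotonicity that projections give.

Consequence for the re-audit: every completion of a line for `X` proves `VNP ℂ ⊄ VQP ℂ`; the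
RESTATED bin is confirmed by a theorem, not only by a reading.  Axioms: `propext`,
`Classical.choice`, `Quot.sound`.

References: [BurgisserClausenShokrollahi1997] (21.32) p. 591, (21.40)–(21.41) p. 598;
[Nisan1991] Thm. 1; [ChatterjeeKumarVolk2024] Thm. 13; [MignonRessayre2004]; [Grenet2011].
-/

-- `Summit.ValiantsHypothesis.ValiantsHypothesis.…` is the tree's mandated single-conjunct layout
-- (Sub = Summit), so the duplicated namespace component is intended.
set_option linter.dupNamespace false

noncomputable section

namespace Summit.ValiantsHypothesis.ValiantsHypothesis.Theorems.LiftNullstellensatzLiftAvoidanceQPCalibration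

open MvPolynomial Matrix
open Literature.Computability.AlgebraicComplexity
open Summit.ValiantsHypothesis.ValiantsHypothesis.Theses (DetQP.DetqpThesis)
open Summit.ValiantsHypothesis.ValiantsHypothesis.Theses.LiftNullstellensatz
  (LiftAvoidanceQP PerLiftQPOfVP)
open Summit.ValiantsHypothesis.ValiantsHypothesis.Theorems.LiftNullstellensatzPerLiftQPOfVP
  (two_pow_mono isWordLift_naive exists_krylov_perPoly exists_isWordLift_of_krylov)
open Summit.ValiantsHypothesis.Theorems.DetqpThesis.Negative
  (detqpThesis_iff_extendedValiantHypothesis)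

/-- **Quasi-polynomial `dc` ⇒ quasi-polynomial lifts, for every `n`.**  If
`n ↦ dc(per_n / ℂ)` is quasi-polynomially bounded then for some `c` and every `n` the permanent
`per_n` has a word lift `Ψ : ([n]×[n])^n → ℂ` all of whose sequential flattenings have rank
`≤ 2^((log₂ n + c)^c)`.  This is the body of the landed `perLiftQPOfVP_proof` (which first derives
the qp bound on `dc` from `IsVPFamily`): `n ≤ 2` by the naive lift (rank `≤ 16`), `n ≥ 3` by the
Krylov normal form of the attained determinantal expression (Chatterjee–Kumar–Volk 2024, Thm. 13;
von zur Gathen 1987) read as a matrix product state (Nisan 1991, Thm. 1, easy direction).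
[cite: ChatterjeeKumarVolk2024, Thm. 13] -/
theorem exists_lifts_of_isQPBounded_dc
    (h : IsQPBounded fun n => determinantalComplexity (perPoly (Fin n) ℂ)) :
    ∃ c : ℕ, ∀ n : ℕ, ∃ Ψ : (Fin n → Fin n × Fin n) → ℂ,
      IsWordLift Ψ (perPoly (Fin n) ℂ) ∧
        ∀ (a b : ℕ) (hab : a + b = n),
          (wordFlattening Ψ a b hab).rank ≤ 2 ^ ((Nat.log 2 n + c) ^ c) := by
  obtain ⟨c, hc⟩ := h
  refine ⟨c + 2, fun n => ?_⟩
  obtain ⟨hmono, h16⟩ := two_pow_mono (Nat.log 2 n) c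
  rcases lt_or_ge n 3 with hn | hn
  · -- small `n`: the naive lift, rank ≤ number of columns ≤ 16
    refine ⟨_, isWordLift_naive n, fun a b hab => ?_⟩
    refine (Matrix.rank_le_card_width _).trans ?_
    rw [Fintype.card_fun, Fintype.card_prod, Fintype.card_fin, Fintype.card_fin]
    have hn2 : n ≤ 2 := by omega
    have hnn : n * n ≤ 4 := (Nat.mul_le_mul hn2 hn2).trans (by norm_num)
    calc (n * n) ^ b ≤ 4 ^ b := Nat.pow_le_pow_left hnn b
      _ ≤ 4 ^ 2 := Nat.pow_le_pow_right (by norm_num) (by omega)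
      _ = 16 := by norm_num
      _ ≤ _ := h16
  · -- `n ≥ 3`: Krylov normal form of the attained determinantal expression
    have hdc := hc n
    have hdeg : (perPoly (Fin n) ℂ).totalDegree ≤ determinantalComplexity (perPoly (Fin n) ℂ) :=
      totalDegree_le_determinantalComplexity_holds _
    have htd : (perPoly (Fin n) ℂ).totalDegree = Fintype.card (Fin n) := totalDegree_perPoly_holds
    rw [Fintype.card_fin] at htd
    obtain ⟨w, hw⟩ : ∃ w : ℕ, determinantalComplexity (perPoly (Fin n) ℂ) = w + 1 :=
      ⟨determinantalComplexity (perPoly (Fin n) ℂ) - 1, by omega⟩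
    have hrep : HasDetRepr (perPoly (Fin n) ℂ) (w + 1) :=
      hw ▸ hasDetRepr_determinantalComplexity_holds _
    obtain ⟨ρ, γ, L, hρ, hγ, hL, hper⟩ := exists_krylov_perPoly hn hrep
    have hw1 : 1 ≤ w := by omega
    obtain ⟨Ψ, hΨ, hrank⟩ := exists_isWordLift_of_krylov (K := ℂ) (σ := Fin n × Fin n)
      (m := n - 2) (N := n) (by omega) ⟨0, hw1⟩ ρ γ L hρ hγ hL
    rw [hper] at hΨ
    refine ⟨Ψ, hΨ, fun a b hab => (hrank a b hab).trans ?_⟩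
    calc w ≤ w + 1 := Nat.le_succ w
      _ = determinantalComplexity (perPoly (Fin n) ℂ) := hw.symm
      _ ≤ 2 ^ ((Nat.log 2 n + c) ^ c) := by simpa using hdc
      _ ≤ _ := hmono

/-- **The crux is at least the Extended Valiant Hypothesis**: `LiftAvoidanceQP → ¬ (VNP ℂ ⊆ VQP ℂ)`
(BCS97 (21.32)).  A qp bound on `dc(per_n)` gives qp lifts for every `n`
(`exists_lifts_of_isQPBounded_dc`), contradicting lift avoidance at the threshold `n₀` of the same
exponent; so `X` gives `DetQP.DetqpThesis`, and the landed
`detqpThesis_iff_extendedValiantHypothesis` converts (no separate cross-route edge is declared).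
[cite: BurgisserClausenShokrollahi1997, (21.32) p.591; (21.41) p.598] -/
theorem extendedValiantHypothesis_of_liftAvoidanceQP (hX : LiftAvoidanceQP) :
    ExtendedValiantHypothesis ℂ := by
  refine detqpThesis_iff_extendedValiantHypothesis.mp ?_
  unfold Summit.ValiantsHypothesis.ValiantsHypothesis.Theses.DetQP.DetqpThesis
  intro hqp
  obtain ⟨c, hc⟩ := exists_lifts_of_isQPBounded_dc hqp
  obtain ⟨n₀, hn₀⟩ := hX c
  obtain ⟨Ψ, hΨ, hrank⟩ := hc n₀
  obtain ⟨k, l, h, hlt⟩ := hn₀ n₀ le_rfl Ψ hΨ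
  exact absurd hlt (not_lt.mpr (hrank k l h))

/-- **The almost-everywhere form implies the infinitely-often form** of lift avoidance (the filed
crux is the a.e. form: "for every `c`, for ALL large `n`"; the i.o. form asks only for
arbitrarily large such `n`); the converse would need a regularity property of
`n ↦ liftTTRank (per_n) n` that mere monotonicity under projections does not give. [folklore] -/
theorem liftAvoidanceQP_io_of_ae (hX : LiftAvoidanceQP) :
    ∀ c n₀ : ℕ, ∃ n ≥ n₀, ∀ Ψ : (Fin n → Fin n × Fin n) → ℂ,
      IsWordLift Ψ (perPoly (Fin n) ℂ) →
        ∃ (k l : ℕ) (h : k + l = n), 2 ^ ((Nat.log 2 n + c) ^ c) < (wordFlattening Ψ k l h).rank := by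
  intro c n₀
  obtain ⟨n₁, hn₁⟩ := hX c
  exact ⟨max n₀ n₁, le_max_left _ _, fun Ψ hΨ => hn₁ _ (le_max_right _ _) Ψ hΨ⟩

/-- **The infinitely-often form already decides the route**: together with the (landed) support item
`PerLiftQPOfVP` it yields `DetqpThesis`-style contradiction with any qp bound, hence — by the same
bookkeeping as the route's deciding theorem — it suffices for `ValiantsHypothesis`.  Recorded to
document that the filed a.e. form carries slack the assembly never uses. [folklore] -/
theorem liftAvoidanceQP_io_suffices
    (hio : ∀ c n₀ : ℕ, ∃ n ≥ n₀, ∀ Ψ : (Fin n → Fin n × Fin n) → ℂ,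
      IsWordLift Ψ (perPoly (Fin n) ℂ) →
        ∃ (k l : ℕ) (h : k + l = n), 2 ^ ((Nat.log 2 n + c) ^ c) < (wordFlattening Ψ k l h).rank)
    (hPer : PerLiftQPOfVP) : _root_.ValiantsHypothesis := by
  show Literature.Computability.AlgebraicComplexity.VP ℂ ≠
    Literature.Computability.AlgebraicComplexity.VNP ℂ
  intro hEq
  have hVNP := perFamily_mem_VNP_holds ℂ
  have hVP : perFamily ℂ ∈ VP ℂ := by rw [hEq]; exact hVNP
  have hfam : IsVPFamily (fun n => perPoly (Fin n) ℂ) := (mem_VP_ofFintype_iff_holds _).1 hVP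
  obtain ⟨c, hc⟩ := hPer hfam
  obtain ⟨n, -, hn⟩ := hio c 0
  obtain ⟨Ψ, hΨ, hrank⟩ := hc n
  obtain ⟨k, l, h, hlt⟩ := hn Ψ hΨ
  exact absurd hlt (not_lt.mpr (hrank k l h))

end Summit.ValiantsHypothesis.ValiantsHypothesis.Theorems.LiftNullstellensatzLiftAvoidanceQPCalibration

end
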